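import Mathlib

/-!
# Moment determinacy under exponential moments, and rotation invariance from radial moments

Support file for item `DilutionTransfer` (stmt-CriticalPhenomena-6037) of route
`HarmonicMomentsIsotropy` (sub-problem `Ising3DConformalLimit`).

* `complexMGF_mul_I_eq_of_moments_eq` — two real random variables whose moment generating
  functions are finite on a common interval `[-t, t]`, `t > 0`, and whose moments all agree have the
  same complex mgf on the imaginary axis (Taylor expansion at `0` + identity theorem on the strip
  `|Re z| < t`; Mathlib: `analyticOnNhd_complexMGF`, `iteratedDeriv_complexMGF`,
  `Complex.hasSum_taylorSeries_on_ball`);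
* `ext_of_inner_moments` — on a finite-dimensional real inner product space, two probability
  measures with an exponential moment `∫ e^{c‖y‖} < ∞` and equal moments `∫ ⟪y, ξ⟫ⁿ` of every
  one-dimensional marginal are equal (Cramér–Wold via `Measure.ext_of_charFun`);
* `map_linearIsometryEquiv_eq_self_of_radial_moments` — if moreover the marginal moments
  `∫ ⟪y, ξ⟫ⁿ dν` depend on `ξ` only through `‖ξ‖`, then `ν` is invariant under every linear isometry.

References: the moment problem under Cramér's condition is classical (e.g. P. Billingsley,
*Probability and Measure*, Thm. 30.1); the proofs here are self-contained on top of Mathlib.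
-/

noncomputable section

open MeasureTheory ProbabilityTheory Complex Filter Topology Set
open scoped Real RealInnerProductSpace

namespace Summit.CriticalPhenomena.Ising3DConformalLimit.Theorems.HarmonicMomentsIsotropy.Determinacy

section OneDim

variable {Ω Ω' : Type*} [MeasurableSpace Ω] [MeasurableSpace Ω'] {μ : Measure Ω} {μ' : Measure Ω'}
  {X : Ω → ℝ} {Y : Ω' → ℝ}

/-- The vertical strip `|Re z| < t` lies in the analyticity strip of `complexMGF X μ` as soon as
`[-t, t] ⊆ integrableExpSet X μ`. -/
theorem strip_subset_of_Icc_subset {t : ℝ} (hX : Icc (-t) t ⊆ integrableExpSet X μ) :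
    {z : ℂ | z.re ∈ Ioo (-t) t} ⊆ {z : ℂ | z.re ∈ interior (integrableExpSet X μ)} := by
  intro z hz
  have h : Ioo (-t) t ⊆ interior (integrableExpSet X μ) := by
    rw [← interior_Icc]; exact interior_mono hX
  exact h hz

/-- The moments are the derivatives at `0` of the complex mgf:
`(complexMGF X μ)⁽ⁿ⁾(0) = ∫ Xⁿ dμ`. -/
theorem iteratedDeriv_complexMGF_zero {t : ℝ} (ht : 0 < t) (hX : Icc (-t) t ⊆ integrableExpSet X μ)
    (n : ℕ) : iteratedDeriv n (complexMGF X μ) 0 = ((∫ ω, X ω ^ n ∂μ : ℝ) : ℂ) := by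
  have h0 : (0 : ℂ).re ∈ interior (integrableExpSet X μ) :=
    strip_subset_of_Icc_subset hX (show (0 : ℂ).re ∈ Ioo (-t) t by simp [ht])
  rw [iteratedDeriv_complexMGF h0 n]
  simp only [zero_mul, Complex.exp_zero, mul_one]
  rw [← integral_complex_ofReal]
  simp

/-- **Equal moments and a common exponential moment force equal complex mgf on the imaginary
axis.** If `[-t, t]` (`t > 0`) is contained in the `integrableExpSet` of `X` under `μ` and of `Y`
under `μ'`, and `∫ Xⁿ dμ = ∫ Yⁿ dμ'` for all `n`, then
`complexMGF X μ (s i) = complexMGF Y μ' (s i)` for every real `s`. -/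
theorem complexMGF_mul_I_eq_of_moments_eq {t : ℝ} (ht : 0 < t)
    (hX : Icc (-t) t ⊆ integrableExpSet X μ) (hY : Icc (-t) t ⊆ integrableExpSet Y μ')
    (hmom : ∀ n : ℕ, ∫ ω, X ω ^ n ∂μ = ∫ ω, Y ω ^ n ∂μ') (s : ℝ) :
    complexMGF X μ (s * I) = complexMGF Y μ' (s * I) := by
  set U : Set ℂ := {z : ℂ | z.re ∈ Ioo (-t) t} with hU
  have hUX := strip_subset_of_Icc_subset hX
  have hUY := strip_subset_of_Icc_subset hY
  have hfX : AnalyticOnNhd ℂ (complexMGF X μ) U := analyticOnNhd_complexMGF.mono hUX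
  have hfY : AnalyticOnNhd ℂ (complexMGF Y μ') U := analyticOnNhd_complexMGF.mono hUY
  have hUpre : IsPreconnected U :=
    ((convex_Ioo (-t) t).linear_preimage Complex.reLm).isPreconnected
  have h0U : (0 : ℂ) ∈ U := by simp [hU, ht]
  have hball : Metric.ball (0 : ℂ) t ⊆ U := by
    intro z hz
    rw [Metric.mem_ball, dist_zero_right] at hz
    have h := (abs_le.1 ((Complex.abs_re_le_norm z).trans hz.le))
    have h' : |z.re| < t := lt_of_le_of_lt (Complex.abs_re_le_norm z) hz
    simp only [hU, mem_setOf_eq, mem_Ioo]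
    exact ⟨by linarith [(abs_lt.1 h').1], (abs_lt.1 h').2⟩
  have hdX : DifferentiableOn ℂ (complexMGF X μ) (Metric.ball 0 t) :=
    differentiableOn_complexMGF.mono (hball.trans hUX)
  have hdY : DifferentiableOn ℂ (complexMGF Y μ') (Metric.ball 0 t) :=
    differentiableOn_complexMGF.mono (hball.trans hUY)
  have hderiv : ∀ n, iteratedDeriv n (complexMGF X μ) 0 = iteratedDeriv n (complexMGF Y μ') 0 := by
    intro n
    rw [iteratedDeriv_complexMGF_zero ht hX, iteratedDeriv_complexMGF_zero ht hY, hmom n]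
  have heq_ball : EqOn (complexMGF X μ) (complexMGF Y μ') (Metric.ball 0 t) := by
    intro z hz
    have h1 := Complex.hasSum_taylorSeries_on_ball hdX hz
    have h2 := Complex.hasSum_taylorSeries_on_ball hdY hz
    simp only [sub_zero, hderiv] at h1 h2
    exact h1.unique h2
  have hev : complexMGF X μ =ᶠ[𝓝 0] complexMGF Y μ' :=
    Filter.eventuallyEq_of_mem (Metric.ball_mem_nhds 0 ht) heq_ball
  have hEqOn := hfX.eqOn_of_preconnected_of_eventuallyEq hfY hUpre h0U hev
  exact hEqOn (show (s : ℂ) * I ∈ U by simp [hU, ht])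

end OneDim

section InnerProduct

variable {E : Type*} [NormedAddCommGroup E] [InnerProductSpace ℝ E] [FiniteDimensional ℝ E]
  [MeasurableSpace E] [BorelSpace E]

/-- An exponential moment `∫ e^{c‖y‖} dν < ∞` makes `s ↦ ∫ e^{s⟪y,ξ⟫} dν` finite for
`|s| ≤ c/(‖ξ‖+1)`. -/
theorem Icc_subset_integrableExpSet_inner {ν : Measure E} {c : ℝ}
    (hν : Integrable (fun y => Real.exp (c * ‖y‖)) ν) (ξ : E) :
    Icc (-(c / (‖ξ‖ + 1))) (c / (‖ξ‖ + 1)) ⊆ integrableExpSet (fun y => ⟪y, ξ⟫) ν := by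
  intro s hs
  change Integrable (fun y => Real.exp (s * ⟪y, ξ⟫)) ν
  refine hν.mono' (by fun_prop) (ae_of_all _ fun y => ?_)
  rw [Real.norm_eq_abs, abs_of_pos (Real.exp_pos _)]
  apply Real.exp_le_exp.2
  have hs' : |s| ≤ c / (‖ξ‖ + 1) := abs_le.2 ⟨hs.1, hs.2⟩
  have hpos : 0 < ‖ξ‖ + 1 := by positivity
  have hc : 0 ≤ c := by
    have h1 : 0 ≤ c / (‖ξ‖ + 1) := (neg_le_self_iff).1 (hs.1.trans hs.2)
    have h2 := mul_nonneg h1 hpos.le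
    rwa [div_mul_cancel₀ _ hpos.ne'] at h2
  calc s * ⟪y, ξ⟫ ≤ |s * ⟪y, ξ⟫| := le_abs_self _
    _ = |s| * |⟪y, ξ⟫| := abs_mul _ _
    _ ≤ (c / (‖ξ‖ + 1)) * (‖y‖ * ‖ξ‖) :=
        mul_le_mul hs' (abs_real_inner_le_norm y ξ) (abs_nonneg _) (by positivity)
    _ = c * ‖y‖ * (‖ξ‖ / (‖ξ‖ + 1)) := by ring
    _ ≤ c * ‖y‖ * 1 := by
        refine mul_le_mul_of_nonneg_left ?_ (by positivity)
        rw [div_le_one hpos]; linarith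
    _ = c * ‖y‖ := mul_one _

omit [FiniteDimensional ℝ E] [BorelSpace E] in
/-- The characteristic function at `ξ` is the complex mgf of the marginal `⟪·, ξ⟫` at `i`. -/
theorem charFun_eq_complexMGF_inner (ν : Measure E) (ξ : E) :
    charFun ν ξ = complexMGF (fun y => ⟪y, ξ⟫) ν ((1 : ℝ) * I) := by
  rw [charFun_apply, complexMGF]
  congr 1 with y
  push_cast
  ring_nf

/-- **Cramér–Wold under an exponential moment.** Two probability measures on a
finite-dimensional real inner product space having an exponential moment and the same moments
`∫ ⟪y, ξ⟫ⁿ` for every `ξ` and `n` coincide. -/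
theorem ext_of_inner_moments {ν ν' : Measure E} [IsProbabilityMeasure ν]
    [IsProbabilityMeasure ν'] {c : ℝ} (hc : 0 < c)
    (hν : Integrable (fun y => Real.exp (c * ‖y‖)) ν)
    (hν' : Integrable (fun y => Real.exp (c * ‖y‖)) ν')
    (hmom : ∀ (ξ : E) (n : ℕ), ∫ y, ⟪y, ξ⟫ ^ n ∂ν = ∫ y, ⟪y, ξ⟫ ^ n ∂ν') : ν = ν' := by
  apply Measure.ext_of_charFun
  funext ξ
  have ht : 0 < c / (‖ξ‖ + 1) := by positivity
  have key := complexMGF_mul_I_eq_of_moments_eq ht (Icc_subset_integrableExpSet_inner hν ξ)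
    (Icc_subset_integrableExpSet_inner hν' ξ) (hmom ξ) 1
  rw [charFun_eq_complexMGF_inner, charFun_eq_complexMGF_inner]
  exact key

/-- **Rotation invariance from radial marginal moments.** Let `ν` be a probability measure on a
finite-dimensional real inner product space with an exponential moment. If the marginal moments
`∫ ⟪y, ξ⟫ⁿ dν` depend on `ξ` only through `‖ξ‖`, then `ν` is invariant under every linear isometry
(`O(d)`, reflections included). -/
theorem map_linearIsometryEquiv_eq_self_of_radial_moments {ν : Measure E} [IsProbabilityMeasure ν]
    {c : ℝ} (hc : 0 < c) (hν : Integrable (fun y => Real.exp (c * ‖y‖)) ν)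
    (hrad : ∀ ξ ξ' : E, ‖ξ‖ = ‖ξ'‖ → ∀ n : ℕ, ∫ y, ⟪y, ξ⟫ ^ n ∂ν = ∫ y, ⟪y, ξ'⟫ ^ n ∂ν)
    (R : E ≃ₗᵢ[ℝ] E) : ν.map R = ν := by
  have hRm : AEMeasurable (R : E → E) ν := R.continuous.measurable.aemeasurable
  haveI : IsProbabilityMeasure (ν.map R) := Measure.isProbabilityMeasure_map hRm
  refine ext_of_inner_moments hc ?_ hν ?_
  · have h := (integrable_map_equiv R.toHomeomorph.toMeasurableEquiv
      (fun y : E => Real.exp (c * ‖y‖)) (μ := ν)).2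
    have hcomp : Integrable ((fun y : E => Real.exp (c * ‖y‖)) ∘ R.toHomeomorph.toMeasurableEquiv) ν := by
      have : ((fun y : E => Real.exp (c * ‖y‖)) ∘ R.toHomeomorph.toMeasurableEquiv) =
          fun y : E => Real.exp (c * ‖y‖) := by
        funext y
        simp [Function.comp]
      rw [this]; exact hν
    exact h hcomp
  · intro ξ n
    rw [integral_map hRm (by fun_prop)]
    have h1 : ∀ y : E, ⟪R y, ξ⟫ = ⟪y, R.symm ξ⟫ := fun y => by
      rw [← R.inner_map_map y (R.symm ξ), R.apply_symm_apply]
    simp_rw [h1]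
    exact hrad _ _ (by simp) n

end InnerProduct

end Summit.CriticalPhenomena.Ising3DConformalLimit.Theorems.HarmonicMomentsIsotropy.Determinacy

end
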